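import Literature.AlgebraicGeometry.Modules.Biduality
import Mathlib.CategoryTheory.Preadditive.AdditiveFunctor
import Mathlib.CategoryTheory.Limits.Preserves.Shapes.Products
import Mathlib.CategoryTheory.Adjunction.Limits
import HarnessLib

/-!
# The twist `𝓗om(E^∨, F)` by a GLOBALLY FREE module `F ≅ 𝒪_X^{⊕N}` is `E^{⊕N}`, and its direct image

Layer `Literature/AlgebraicGeometry/Modules`; general scheme theory, everything PROVED (constructions + lemmas, no named fact).
For a scheme `X`, an `𝒪_X`-module `F` with a GLOBAL frame `e : F ≅ ∏_{Fin N} 𝒪_X` and a finite locally free `E`, the model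
`𝓗om(E^∨, F)` of `E ⊗ F` (the tree's `twistFunctor`, `HodgeTheory/HigherSigmaOfIso`, on maps the double transpose
`𝓗om(𝓗om(φ, 𝒪), F)` = `sheafHomMapLeft (sheafHomMapLeft φ 𝒪) F`) is

  `𝓗om(E^∨, F) ≅[e] 𝓗om(E^∨, ∏ 𝒪) ≅ ∏ 𝓗om(E^∨, 𝒪) = ∏ E^∨∨ ≅[biduality⁻¹] ∏_{Fin N} E = E^{⊕N}`

(`twistFreeIso`; Hartshorne II Ex. 5.1 (a)–(b): `𝓗om(E^∨, 𝒪) = E^∨∨ ≅ E`, `𝓗om(E, ∏ M_i) = ∏ 𝓗om(E, M_i)`; finite products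
= finite direct sums in the additive category `Mod(𝒪_X)`, written as Mathlib's categorical products `∏ᶜ` over `Fin N`, which need
no biproduct instance), NATURAL in `E` on the finite locally free modules (`twistFreeIso_naturality`: biduality is a natural
transformation, the tree's `toBidual_naturality`). Consequently, for a morphism `f : X ⟶ Y`, frames `e_X : F_X ≅ ∏_N 𝒪_X`,
`e_Y : F_Y ≅ ∏_N 𝒪_Y` of the same rank and `E` finite locally free with `f_*E` finite locally free,

  `f_*𝓗om(E^∨, F_X) ≅ f_*(∏ E) ≅ ∏ f_*E ≅ 𝓗om((f_*E)^∨, F_Y)`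

(`pushforwardTwistFreeIso`; `f_*` is a right adjoint), again natural in `E` (`pushforwardTwistFreeIso_naturality`), and the same
with an automorphism `θ` of `F_X` inserted on the source (`pushforwardTwistFreeIso'`, `…'_naturality`) — the slot through which
a consumer puts the differential `dg` of `f` when `F = Ω^q` (the projection formula `f_*(E ⊗ f^*L) ≅ f_*E ⊗ L` read in global
frames: Hartshorne II Ex. 5.1 (d)).

Motivation: the Hodge road's data node (L7b) `IsogenyTwistPushforwardIso` (`Summits/HodgeConjecture/…/VHCAbelianSchemesRoadIsogeny
PushforwardISemiregularCTransfer.lean`): `g_*•(K• ⊗ Ω^q_A) ≅ (g_*•K•) ⊗ Ω^q_A` for an isogeny `g` of a complex abelian variety in the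
free-cotangent model `Ω^q_A ≅ 𝒪_A^{C(dim A, q)}` (Mumford AV §4 (iii)).

## References
* [Hartshorne1977] R. Hartshorne, Algebraic Geometry (1977), II Ex. 5.1 (a), (b), (d) (p. 123–124); II §5 p. 109 (sheaf Hom).
* [StacksProject] The Stacks project, Tag 01CM (internal Hom of sheaves of modules).
-/

noncomputable section

-- `TopCat.Presheaf`/`Scheme.Modules` are not reducible (as in Mathlib's `AlgebraicGeometry/Modules/Sheaf.lean`).
set_option backward.isDefEq.respectTransparency false

open CategoryTheory CategoryTheory.Limits AlgebraicGeometry Opposite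
open AlgebraicGeometry.Scheme.Modules

universe u

namespace Literature.AlgebraicGeometry.Modules

open Literature.AlgebraicGeometry.Motives

variable {X Y : Scheme.{u}} {N : ℕ}

/-! ### `𝓗om(E^∨, F) ≅ E^{⊕N}` for a globally free `F` of rank `N` and a vector bundle `E` -/

section Twist

variable {F : X.Modules} (e : F ≅ ∏ᶜ fun _ : Fin N => unitModule X) (E : X.Modules) (hE : IsFiniteLocallyFree E)

/-- **`𝓗om(E^∨, F) ≅ ∏_{Fin N} E = E^{⊕N}`** for a global frame `e : F ≅ ∏_{Fin N} 𝒪_X` and `E` finite locally free: post-compose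
with the frame, distribute `𝓗om(E^∨, –)` over the finite product (an additive functor preserves finite products), and undo
biduality `E ≅ E^∨∨` factorwise. [cite: Hartshorne1977, II Ex. 5.1 (a)–(b)] -/
def twistFreeIso : sheafHom (dual E) F ≅ ∏ᶜ fun _ : Fin N => E :=
  haveI := isIso_toBidual E hE
  (sheafHomFunctor (dual E)).mapIso e ≪≫ PreservesProduct.iso (sheafHomFunctor (dual E)) (fun _ : Fin N => unitModule X) ≪≫
    Limits.Pi.mapIso fun _ : Fin N => (asIso (toBidual E (unitModule X))).symm

/-- Components of `twistFreeIso`: `(twistFreeIso e E).hom ≫ π_i = 𝓗om(E^∨, e ≫ π_i) ≫ (E ≅ E^∨∨)⁻¹`.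
[cite: Hartshorne1977, II Ex. 5.1 (a)–(b)] -/
@[reassoc]
theorem twistFreeIso_hom_π (i : Fin N) :
    haveI := isIso_toBidual E hE
    (twistFreeIso e E hE).hom ≫ Limits.Pi.π _ i =
      sheafHomMap (dual E) (e.hom ≫ Limits.Pi.π _ i) ≫ inv (toBidual E (unitModule X)) := by
  haveI := isIso_toBidual E hE
  change ((sheafHomFunctor (dual E)).map e.hom ≫ (PreservesProduct.iso (sheafHomFunctor (dual E))
    (fun _ : Fin N => unitModule X)).hom ≫ (Limits.Pi.mapIso fun _ : Fin N =>
      (asIso (toBidual E (unitModule X))).symm).hom) ≫ Limits.Pi.π _ i = _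
  rw [Category.assoc, Category.assoc, Limits.Pi.mapIso_hom_π, PreservesProduct.iso_hom]
  erw [piComparison_comp_π_assoc (sheafHomFunctor (dual E)) (fun _ : Fin N => unitModule X) i]
  rw [← Functor.map_comp_assoc]
  rfl

variable {E} {E' : X.Modules} (hE' : IsFiniteLocallyFree E') (φ : E ⟶ E')

/-- **Naturality of `twistFreeIso` in the vector bundle**: for `φ : E → E'` between finite locally free modules,
`𝓗om(φ^∨∨, F) ≫ twistFreeIso E' = twistFreeIso E ≫ ∏ φ` (biduality is a natural transformation). [cite: Hartshorne1977, II Ex. 5.1 (a)] -/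
@[reassoc]
theorem twistFreeIso_naturality :
    sheafHomMapLeft (sheafHomMapLeft φ (unitModule X)) F ≫ (twistFreeIso e E' hE').hom =
      (twistFreeIso e E hE).hom ≫ Limits.Pi.map fun _ : Fin N => φ := by
  haveI := isIso_toBidual E hE
  haveI := isIso_toBidual E' hE'
  refine Limits.Pi.hom_ext _ _ fun i => ?_
  rw [Category.assoc, Category.assoc, twistFreeIso_hom_π, Limits.Pi.map_π, twistFreeIso_hom_π_assoc,
    sheafHomMapLeft_sheafHomMap_assoc]
  congr 1
  -- `𝓗om(φ^∨∨, 𝒪) ≫ (E' ≅ E'^∨∨)⁻¹ = (E ≅ E^∨∨)⁻¹ ≫ φ`: biduality is natural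
  rw [IsIso.eq_inv_comp, ← Category.assoc, IsIso.comp_inv_eq]
  exact (toBidual_naturality (unitModule X) φ).symm

end Twist

/-! ### The direct image of a twist by a globally free module, in global frames on source and target -/

section Pushforward

variable (f : X ⟶ Y) {FX : X.Modules} {FY : Y.Modules} (eX : FX ≅ ∏ᶜ fun _ : Fin N => unitModule X)
  (eY : FY ≅ ∏ᶜ fun _ : Fin N => unitModule Y) (E : X.Modules) (hE : IsFiniteLocallyFree E)
  (hfE : IsFiniteLocallyFree ((pushforward f).obj E))

/-- **`f_*𝓗om(E^∨, F_X) ≅ 𝓗om((f_*E)^∨, F_Y)`** for global frames `F_X ≅ 𝒪_X^{⊕N}`, `F_Y ≅ 𝒪_Y^{⊕N}` of the SAME rank and `E`,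
`f_*E` finite locally free: `f_*(∏_N E) ≅ ∏_N f_*E` (`f_*` is a right adjoint) between the two `twistFreeIso`s. (The projection formula
`f_*(E ⊗ f^*L) ≅ f_*E ⊗ L` for a free `L`, read in frames.) [cite: Hartshorne1977, II Ex. 5.1 (d) (projection formula) and (b)] -/
def pushforwardTwistFreeIso :
    (pushforward f).obj (sheafHom (dual E) FX) ≅ sheafHom (dual ((pushforward f).obj E)) FY :=
  (pushforward f).mapIso (twistFreeIso eX E hE) ≪≫ PreservesProduct.iso (pushforward f) (fun _ : Fin N => E) ≪≫
    (twistFreeIso eY ((pushforward f).obj E) hfE).symm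

/-- Unfolding of `pushforwardTwistFreeIso` (`f_*` of the source frame isomorphism, the product comparison, the inverse target
frame isomorphism). [cite: Hartshorne1977, II Ex. 5.1 (b), (d)] -/
theorem pushforwardTwistFreeIso_hom :
    (pushforwardTwistFreeIso f eX eY E hE hfE).hom = (pushforward f).map (twistFreeIso eX E hE).hom ≫
      (PreservesProduct.iso (pushforward f) (fun _ : Fin N => E)).hom ≫ (twistFreeIso eY ((pushforward f).obj E) hfE).inv :=
  rfl

variable {E} {E' : X.Modules} (hE' : IsFiniteLocallyFree E') (hfE' : IsFiniteLocallyFree ((pushforward f).obj E'))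
  (φ : E ⟶ E')

/-- **Naturality of `pushforwardTwistFreeIso` in the vector bundle**: for `φ : E → E'` (all four modules finite locally free),
`f_*𝓗om(φ^∨∨, F_X) ≫ iso(E') = iso(E) ≫ 𝓗om((f_*φ)^∨∨, F_Y)`. [cite: Hartshorne1977, II Ex. 5.1 (b), (d)] -/
@[reassoc]
theorem pushforwardTwistFreeIso_naturality :
    (pushforward f).map (sheafHomMapLeft (sheafHomMapLeft φ (unitModule X)) FX) ≫
        (pushforwardTwistFreeIso f eX eY E' hE' hfE').hom =
      (pushforwardTwistFreeIso f eX eY E hE hfE).hom ≫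
        sheafHomMapLeft (sheafHomMapLeft ((pushforward f).map φ) (unitModule Y)) FY := by
  rw [pushforwardTwistFreeIso_hom, pushforwardTwistFreeIso_hom]
  -- move across the first `twistFreeIso` (pushed forward)
  rw [← Functor.map_comp_assoc, twistFreeIso_naturality eX hE hE' φ, Functor.map_comp_assoc]
  simp only [Category.assoc]
  congr 1
  -- move across the second `twistFreeIso` (on `Y`)
  have h' : (twistFreeIso eY ((pushforward f).obj E) hfE).inv ≫
      sheafHomMapLeft (sheafHomMapLeft ((pushforward f).map φ) (unitModule Y)) FY =
      (Limits.Pi.map fun _ : Fin N => (pushforward f).map φ) ≫ (twistFreeIso eY ((pushforward f).obj E') hfE').inv := by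
    rw [Iso.inv_comp_eq, ← Category.assoc, Iso.eq_comp_inv]
    exact twistFreeIso_naturality eY hfE hfE' ((pushforward f).map φ)
  rw [h', ← Category.assoc, ← Category.assoc (PreservesProduct.iso (pushforward f) fun _ : Fin N => E).hom]
  congr 1
  -- move across the product comparison
  refine Limits.Pi.hom_ext _ _ fun i => ?_
  rw [Category.assoc, Category.assoc, Limits.Pi.map_π, PreservesProduct.iso_hom, PreservesProduct.iso_hom]
  erw [piComparison_comp_π (pushforward f) (fun _ : Fin N => E') i,
    piComparison_comp_π_assoc (pushforward f) (fun _ : Fin N => E) i]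
  rw [← Functor.map_comp, ← Functor.map_comp, Limits.Pi.map_π]

/-! ### The same with an automorphism of the source frame module inserted (the slot for `dg`) -/

variable (E) (θ : FX ≅ FX)

/-- **`f_*𝓗om(E^∨, F_X) ≅ 𝓗om((f_*E)^∨, F_Y)` twisted by an automorphism `θ` of `F_X`**: `f_*𝓗om(E^∨, θ)` followed by
`pushforwardTwistFreeIso` (for `F = Ω^q` along a finite étale `f` the consumer takes `θ` = the frame-transported inverse of
`df : f^*Ω^q ≅ Ω^q`, which makes the composite the canonical projection-formula isomorphism). [cite: Hartshorne1977, II Ex. 5.1 (d)] -/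
def pushforwardTwistFreeIso' :
    (pushforward f).obj (sheafHom (dual E) FX) ≅ sheafHom (dual ((pushforward f).obj E)) FY :=
  (pushforward f).mapIso ((sheafHomFunctor (dual E)).mapIso θ) ≪≫ pushforwardTwistFreeIso f eX eY E hE hfE

/-- Unfolding of `pushforwardTwistFreeIso'` (`f_*𝓗om(E^∨, θ)` first). [cite: Hartshorne1977, II Ex. 5.1 (b), (d)] -/
theorem pushforwardTwistFreeIso'_hom :
    (pushforwardTwistFreeIso' f eX eY E hE hfE θ).hom =
      (pushforward f).map (sheafHomMap (dual E) θ.hom) ≫ (pushforwardTwistFreeIso f eX eY E hE hfE).hom :=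
  rfl

variable {E}

/-- Naturality of `pushforwardTwistFreeIso'` in the vector bundle (post-composition with `θ` commutes with the double transpose
of `φ`). [cite: Hartshorne1977, II Ex. 5.1 (b), (d)] -/
@[reassoc]
theorem pushforwardTwistFreeIso'_naturality :
    (pushforward f).map (sheafHomMapLeft (sheafHomMapLeft φ (unitModule X)) FX) ≫
        (pushforwardTwistFreeIso' f eX eY E' hE' hfE' θ).hom =
      (pushforwardTwistFreeIso' f eX eY E hE hfE θ).hom ≫
        sheafHomMapLeft (sheafHomMapLeft ((pushforward f).map φ) (unitModule Y)) FY := by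
  rw [pushforwardTwistFreeIso'_hom, pushforwardTwistFreeIso'_hom, ← Category.assoc, ← Functor.map_comp,
    sheafHomMapLeft_sheafHomMap, Functor.map_comp, Category.assoc,
    pushforwardTwistFreeIso_naturality f eX eY hE hfE hE' hfE' φ, Category.assoc]

end Pushforward

end Literature.AlgebraicGeometry.Modules

end
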